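import Summits.BirchSwinnertonDyer.Rank1Residual.X11b.ShaAnBinderFromIndexRecordPow
import Summits.BirchSwinnertonDyer.Rank1Residual.X11b.Three.TamagawaAtomSelmerCertificate
import HarnessLib

/-!
# X11b at `p = 3` (and every odd `p`), the Tamagawa atom (T2′) `#Ш_an = 9` rows: the `#Ш_an` binder
# `hs : shaAn W = s` of the LB3+JET road (Miller 2011 Thm. 5.4, Cha case) DISCHARGED from the EXACT
# Gross–Zagier index record (cell `b2b-bsdres`, unit `x11b` gen 21; sibling of
# `ShaAnBinderFromIndexRecord.lean` (gen 19) and `ShaAnBinderFromIndexRecordPow.lean` (gen 20))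

HONEST FRAMING (cell `b2b-bsdres`, run/shared/lean/b2b/bsd-rank1-residual/, verbatim in every
file): the goal of the cell is to DELETE the COMBINATION-SHAPED residual classes of the
Birch–Swinnerton-Dyer formula for ALL analytic-rank `≤ 1` elliptic curves over `ℚ` — "full BSD
formula for every rank `≤ 1` curve in class `C`" assembled STRICTLY from published theorems — so
that the rank-`≤ 1` remainder becomes exactly the CONSTRUCTION-SHAPED classes, which are TYPED
(missing-input `Prop`s), NOT attempted. This is not "finishing BSD". X11b (multiplicative `p`,
`r = 1`) and X11 ∧ `r = 1` ∧ `p = 3` stay CONSTRUCTION-SHAPED (referee A R6.2). Per pair; research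
route; nothing is booked by this file (the lane certifies, the referee books); no mark / label /
count moves. Every declaration below consumes the tree's named fact
`Miller2011.thm54_cha_padicValNat_shaOrder_add_tamagawa_le` and therefore carries its FLAG
`Miller11-Thm54-Cha-case` (the printed proof of Miller's Thm. 5.4 is the citation of Jetchev 2008,
whose Cor. 1.5 is printed under Hypothesis (∗) "`p ∤ 2N`, `ρ̄_{E,p}` surjective"), and — because here
`p ∥ N` — the lane's reading flag `JET@p|N` (bsdN/HYPOTHESES.md v2, referee A G28): pairs closed through
this file are to be booked WITH BOTH FLAGS at the referee's discretion, never silently (team x11b3's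
`X11b/Three/TamagawaAtomSelmerCertificate.lean`, unit x11c's `X11b/JetchevChaRoute.lean`, verbatim).
THEOREMS ONLY (no definition, no named fact, no `sorry`): tree theorems are composed in each
declaration, nothing is re-proved.

## What the file does

Gen 19/20 (`ShaAnBinderFromIndexRecord.lean`, `ShaAnBinderFromIndexRecordPow.lean`) removed the
binder `hs : shaAn W = (s : ℂ)` (with `ord_p s = 0`, `≤ j`, `= 2`) from the T-SELp / A1 / KOLY / LB3 /
LB3SUB / LB3+KOLY per-pair roads of the X11b@3 rank-one residue, using multr1-p2's exact identity
`X11b.exists_shaAn_padicVal_eq_of_heegner` (Jetchev–Skinner–Wan 2017 (eq:gz for K′) + (eq:tamK)):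
`ord_p #Ш(E)_an = 2·ord_p [E(K):ℤP] − ord_p q_d − ord_p ∏c_ℓ(E)` at a rank-one pair with `E[p]`
irreducible (`P` the Heegner point of a parametrisation datum with `p ∤ c`, `K` Heegner with
`p ∤ #𝓞_K^×`, minimal twist model with `ord_p u = 0`, `q_d = L(E^{d_K},1)/Ω ∈ ℚ^×`). ONE road of
record was left with its `hs`: team x11b3's LB3+JET consumer for the Tamagawa atom (T2′)
(`3 ∣ ∏c_ℓ`), `X11b.Three.bsdp_of_millerJetchev_of_card_selmer` /
`X11b.Three.IsX11Three.bsdp_of_millerJetchev_of_card_selmerThree_eq` (p249303, 2026-08-21): UPPER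
half Miller 2011 Thm. 5.4 in Cha's case (`ord_p #Ш(E/ℚ) ≤ 2·(ord_p I_K − max_q ord_p c_q)`, `p² ∤ N`
so `p ∥ N` is allowed by the printed statement; x10's `missingUpperBoundAt_of_millerJetchev_of_index_le`)
from the Tamagawa-INFLATED index certificate `ord_p [E(K):ℤP] ≤ k + ord_p c_q(E)` at ONE prime
`q ∣ N`, LOWER half the exact `p`-descent `#Sel^(p)(E/ℚ) = p^(1+2k)`, and `hs`/`hv : ord_p s = 2k`.
This file does for it what gen 20 did for LB3+KOLY:

* §1 (class-free, any odd `p`, `E[p]` irreducible) `exists_shaAn_padicValRat_eq_of_indexRecord`: the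
  record EQUATION `2·ord_p [E(K):ℤP] = j + ord_p q_d + ord_p ∏c_ℓ(E)` gives `#Ш(E)_an = q ∈ ℚ` with
  `ord_p q = j`; and `bsdp_of_millerJetchev_of_card_selmer_of_indexRecord`: Cha's binders verbatim
  (`p ∤ d_K`, `p² ∤ N`, non-CM), the inflated index certificate at ONE `q ∣ N`, the record equation
  with `j = 2k`, ONE exact `p`-descent `#Sel^(p)(E/ℚ) = p^(1+2k)` ⇒ `BSD(E,p)` — NO `hs`.
* §2 (conductor level, X11b vocabulary) `ClassX11b.bsdp_of_millerJetchev_of_card_selmer_of_indexRecord`: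
  on `ClassX11b W p` (`r_an = 1 ∧ p ≠ 2 ∧ mult(p) ∧ irr(p)`) at a Heegner field with `d_K < −4`
  EVERY side condition of Cha's theorem is DISCHARGED — `p ∤ w_K = 2`
  (`X2.not_dvd_unitsTorsionOrder_of_discr_lt`), `ord_p u(Cd) = 0` (`padicValRat_u_eq_zero_of_twist_minimal`),
  `p ∤ d_K` (`p ∣ N_E` splits in `K`: `SatisfiesHeegnerHypothesis.not_dvd_discr`), `p² ∤ N_E`
  (`not_sq_dvd_conductorNorm_of_mult`), non-CM (`not_mult_of_hasCM`); what remains per pair is the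
  datum (`K`, `P`, `q_d`, `p ∤ c(Dt)`), ONE prime `q ∣ N_E` with the inflated index certificate, the
  record equation and the Selmer count.
* §3 (`p = 3`, `IsX11Three` / `ClassX11b W 3` vocabulary): the (T2′) LB3 row shape —
  `#Sel^(3)(E/ℚ) = 27`, ONE prime `q ∣ N_E` with `3 ∣ c_q(E)`, `ord₃ [E(K):ℤP] ≤ 2`, record equation
  `2·ord₃ [E(K):ℤP] = 2 + ord₃ q_d + ord₃ ∏c_ℓ(E)` — and the general-`k` form.

WHAT THIS FILE DOES NOT DO: decide the admissibility of `q_d`, of the index, or of the Manin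
constant of the datum as certificate inputs (referee A; only `p ∤ c(Dt)` is a binder — Mazur 1978
Cor. 4.1, `p² ∤ 4N`, is the printed reason it holds for the optimal parametrisation at `3 ‖ N`),
lift the two reading flags, certify any record, book any pair, or touch a label. EVIDENCE pointers
(lane data and this unit's records, nothing asserted; `HOME/b2b-bsdres-x11b/g21/`): the five (T2′)
LB3 classes of the lane's X11b@3 rank-one residue at `N < 5·10⁵` — `191424ce1`, `318828a1`,
`368358k1`, `463488bg1`, `498525ca1` — have `#Sel₃ = 27` EXACT (x11b gen 9), `ord₃ m = 2`,
`ord₃ S_D = 1`, `v₃(∏c_ℓ) = 1` at the Heegner field of record (`D = −23, −23, −23, −47, −191`), so the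
record equation `4 = 2 + 1 + 1` holds, and the prime `q` with `3 ∣ c_q(E)` is `q = 3` (split `I₆`),
`2` (`IV`), `29` (`IV*`), `3` (split `I₃`), `17` (`IV*`) respectively (kit j252622, `ellglobalred`
on Cremona's minimal models). With gen 19/20 every one of the lane's 20 798 X11b@3 rank-one residue
classes now has an `#Ш_an`-free kernel consumer; the five above ONLY through the two-flag road of
this file. A flag-free closer for them (a Jetchev-type theorem at `p ∣ N`, or a Cassels–Tate
certificate on `Ш[3]`) is NOT supplied here and remains team x11b3's typed target
(`X11b.Three.bsdp_of_jetchevShapeAt_of_card_selmer`, binder `hJ`).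

References: [Miller2011LMS] Thm. 5.2, Thm. 5.4, Def. 1.1 (arXiv:1010.2431 p. 11); [Jetchev2008]
Hypothesis (∗), Cor. 1.5, Rem. 6.2; [JetchevSkinnerWan2017] §7.3.1, §7.4.1; [GrossZagier1986] I.(6.3),
V.§2; [Gross1991] (1.1); [Carayol1986] Thm. (A); [SilvermanAEC2009] VII.1, X.4.2; [SilvermanATAEC1994]
II.6.4; [Mazur1977] III.§5; [Mazur1978] Cor. 4.1; cell files `X11b/Three/TamagawaAtomSelmerCertificate.lean`,
`X10/JetchevTamagawaCertificate.lean`, `X11b/ShaAnBinderFromIndexRecord{,Pow}.lean`, `X11b/ChaRoute.lean`,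
`X11b/TwistTransportUnit.lean`.
-/

noncomputable section

open scoped Classical

open WeierstrassCurve NumberField Literature.NumberTheory.EllipticCurves
  Literature.NumberTheory.EllipticCurves.ModularForms
  Literature.NumberTheory.EllipticCurves.Rank1Residual
  Literature.NumberTheory.EllipticCurves.Rank1Residual.Typed
  Literature.NumberTheory.EllipticCurves.Miller2011
  Literature.NumberTheory.EllipticCurves.KrizLi2019
  Literature.NumberTheory.QuadraticFields

namespace Summit.BirchSwinnertonDyer.Rank1Residual.X11b

/-! ### §1. The record EQUATION with exponent `j`, and the LB+JET road without `hs` (class-free, any odd `p`) -/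

section Record

variable (W : WeierstrassCurve ℚ) [W.IsElliptic] [W.IsGloballyMinimal] (p : ℕ) [Fact p.Prime]
  (N : ℕ) [NeZero N] (K : Type) [Field K] [NumberField K]
  (Dt : ModularParametrizationData W N) (H : HeegnerDatum N (NumberField.discr K)) (ι : K →+* ℂ)
  (P : (W.baseChange K).toAffine.Point)

/-- **The record EQUATION with exponent `j`**: data as in `exists_shaAn_padicValRat_eq_of_heegner_of_irr`
(rank one, `p` odd, `E[p]` irreducible, Heegner datum with `p ∤ c(Dt)`, `p ∤ #𝓞_K^×`, minimal twist
model with `ord_p u = 0`, `q_d ≠ 0`); the record satisfies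
`2·ord_p [E(K):ℤP] = j + ord_p q_d + ord_p ∏_ℓ c_ℓ(E)` ⇒ `#Ш(E)_an = q ∈ ℚ` with `ord_p q = j` — the
pair `(hs, hv)` of every consumer with a two-sided certificate of exponent `j` (`j = 0`: gen 19's
`exists_shaAn_unit_of_indexRecord`). Per pair; nothing booked.
[cite: JetchevSkinnerWan2017, §7.4.1 (eq:gz for K′), pp. 29–30] [cite: Miller2011LMS, §1 and Def. 1.1] -/
theorem exists_shaAn_padicValRat_eq_of_indexRecord
    (hGZ : gross_zagier N W K) (hKo : kolyvagin N W K)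
    (hGZK : rank_eq_analyticRank_of_analyticRank_le_one) (hmod : hasEntireLFunction_rat)
    (hK : IsImaginaryQuadratic K) (hHN : SatisfiesHeegnerHypothesis N K)
    (hP : WeierstrassCurve.Affine.Point.map ι.toRatAlgHom P = heegnerPointComplex Dt H)
    (hp2 : p ≠ 2) (hc : ¬ (p : ℤ) ∣ Dt.c) (hμ : ¬ p ∣ Units.torsionOrder K)
    (hr : W.analyticRank = 1) (hirr : Irr W p)
    (Wd : WeierstrassCurve ℚ) [Wd.IsElliptic] [Wd.IsGloballyMinimal] (Cd : VariableChange ℚ)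
    (hWd : Cd • W.quadraticTwist (NumberField.discr K : ℚ) = Wd)
    (hu : padicValRat p (Cd.u : ℚ) = 0)
    (qd : ℚ) (hqd : Wd.entireLFunction 1 / (Wd.realPeriodRat : ℂ) = (qd : ℂ)) (hqd0 : qd ≠ 0)
    {j : ℕ} (hrec : 2 * (padicValNat p (AddSubgroup.zmultiples P).index : ℤ) =
      j + padicValRat p qd + padicValNat p W.tamagawaProduct) :
    ∃ q : ℚ, shaAn W = (q : ℂ) ∧ padicValRat p q = j := by
  obtain ⟨q, hq, hv⟩ := exists_shaAn_padicValRat_eq_of_heegner_of_irr W p N K Dt H ι P hGZ hKo hGZK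
    hmod hK hHN hP hp2 hc hμ hr hirr Wd Cd hWd hu qd hqd hqd0
  exact ⟨q, hq, by rw [hv]; linarith⟩

/-- **Rank one, odd `p`, Cha's side conditions verbatim (`p ∤ d_K`, `p² ∤ N`, `E[p]` irreducible,
non-CM — `p ∥ N` ALLOWED): `BSD(E,p)` from PUBLISHED theorems, the Tamagawa-inflated Heegner-index
certificate `ord_p [E(K):ℤP] ≤ k + ord_p c_q(E)` at ONE prime `q ∣ N`, the exact index record with
`2·ord_p [E(K):ℤP] = 2k + ord_p q_d + ord_p ∏_ℓ c_ℓ(E)`, and ONE exact `p`-descent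
`#Sel^(p)(E/ℚ) = p^(1+2k)` — NO `#Ш_an` binder.** Team x11b3's `X11b.Three.bsdp_of_millerJetchev_of_card_selmer`
(UPPER: Miller 2011 Thm. 5.4 in Cha's case, named fact `hMJ`, FLAGS `Miller11-Thm54-Cha-case` and, at
`p ∣ N`, `JET@p|N`; LOWER: `p^{2k} ∣ #Ш(E/ℚ)` from the Selmer count, `E(ℚ)[p] = 0` by irreducibility)
with its binders `hs`/`hv : ord_p s = 2k` REPLACED by the record (§1; `P` = the Heegner point of the
datum, non-torsion by `not_isOfFinAddOrder_heegner_of_rankOne_of_twist`). PUBLISHED binders `hGZ`,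
`hKo`, `hGZK`, `hmod`, `hMJ`. Per pair; NOT a class theorem; nothing booked; to be read WITH BOTH FLAGS.
[cite: Miller2011LMS, Thm. 5.4 and Thm. 5.2 (arXiv:1010.2431 p. 11 L24–L31, L42–L50), Def. 1.1]
[cite: Jetchev2008, Hypothesis (*), Cor. 1.5 (p. 3), Rem. 6.2 (p. 15)]
[cite: JetchevSkinnerWan2017, §7.4.1 (eq:gz for K′), pp. 29–30] [cite: SilvermanAEC2009, Thm. X.4.2(a)] -/
theorem bsdp_of_millerJetchev_of_card_selmer_of_indexRecord
    (hGZ : gross_zagier N W K) (hKo : kolyvagin N W K)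
    (hGZK : rank_eq_analyticRank_of_analyticRank_le_one) (hmod : hasEntireLFunction_rat)
    (hMJ : thm54_cha_padicValNat_shaOrder_add_tamagawa_le)
    (hK : IsImaginaryQuadratic K) (hHN : SatisfiesHeegnerHypothesis N K)
    (hP : WeierstrassCurve.Affine.Point.map ι.toRatAlgHom P = heegnerPointComplex Dt H)
    (hp2 : p ≠ 2) (hc : ¬ (p : ℤ) ∣ Dt.c) (hμ : ¬ p ∣ Units.torsionOrder K)
    (hr : W.analyticRank = 1) (hirr : Irr W p) (hcm : ¬ W.HasCM)
    (hpD : ¬ (p : ℤ) ∣ NumberField.discr K) (hpN : ¬ p ^ 2 ∣ N)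
    (Wd : WeierstrassCurve ℚ) [Wd.IsElliptic] [Wd.IsGloballyMinimal] (Cd : VariableChange ℚ)
    (hWd : Cd • W.quadraticTwist (NumberField.discr K : ℚ) = Wd)
    (hu : padicValRat p (Cd.u : ℚ) = 0)
    (qd : ℚ) (hqd : Wd.entireLFunction 1 / (Wd.realPeriodRat : ℂ) = (qd : ℂ)) (hqd0 : qd ≠ 0)
    -- the certificates: ONE prime `q ∣ N` with the Tamagawa-inflated index bound, the record
    -- equation with exponent `2k`, the Selmer count
    (q : ℕ) [Fact q.Prime] (hqN : q ∣ N) {k : ℕ}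
    (hI : padicValNat p (AddSubgroup.zmultiples P).index ≤
      k + padicValNat p ((W.baseChange ℚ_[q]).localTamagawaNumber ℤ_[q]))
    (hrec : 2 * (padicValNat p (AddSubgroup.zmultiples P).index : ℤ) =
      (2 * k : ℕ) + padicValRat p qd + padicValNat p W.tamagawaProduct)
    (hcard : Nat.card (W.selmerGroup (p : ℤ)) = p ^ (1 + 2 * k)) :
    BSDp W p := by
  obtain ⟨s, hs, hv⟩ := exists_shaAn_padicValRat_eq_of_indexRecord W p N K Dt H ι P hGZ hKo hGZK hmod
    hK hHN hP hp2 hc hμ hr hirr Wd Cd hWd hu qd hqd hqd0 (j := 2 * k) hrec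
  have hnt : ¬ IsOfFinAddOrder P :=
    not_isOfFinAddOrder_heegner_of_rankOne_of_twist W N K Dt H ι P hGZ hmod hK hHN hP hr Wd Cd hWd qd
      hqd hqd0
  exact Three.bsdp_of_millerJetchev_of_card_selmer W p hGZK hMJ hcm hr hp2 hirr hK hHN ⟨Dt, H, ι, hP⟩
    hnt hpD hpN q hqN hI hcard hs (by rw [hv]; push_cast; ring)

end Record

/-! ### §2. Conductor level (X11b): every side condition of Cha's theorem discharged -/

section Conductor

variable (W : WeierstrassCurve ℚ) [W.IsElliptic] [W.IsGloballyMinimal] (p : ℕ) [Fact p.Prime]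
  [NeZero (W.conductorNorm ℤ)] (K : Type) [Field K] [NumberField K]
  (Dt : ModularParametrizationData W (W.conductorNorm ℤ))
  (H : HeegnerDatum (W.conductorNorm ℤ) (NumberField.discr K)) (ι : K →+* ℂ)
  (P : (W.baseChange K).toAffine.Point)

/-- **X11b (`r_an = 1`, `p` odd, multiplicative at `p`, `E[p]` irreducible), EVERY ODD PRIME:
`BSD(E,p)` from PUBLISHED theorems (Gross–Zagier, Kolyvagin, GZK, modularity, Miller 2011 Thm. 5.4
in Cha's case — FLAGS `Miller11-Thm54-Cha-case` + `JET@p|N`), the Tamagawa-inflated index certificate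
`ord_p [E(K):ℤP] ≤ k + ord_p c_q(E)` at ONE prime `q ∣ N_E`, the exact index record at a Heegner
field with `d_K < −4` satisfying `2·ord_p [E(K):ℤP] = 2k + ord_p q_d + ord_p ∏_ℓ c_ℓ(E)`, and ONE
exact `p`-descent `#Sel^(p)(E/ℚ) = p^(1+2k)`** — §1 at the conductor level with EVERY side condition
of Cha's theorem DISCHARGED on the class: `p ∤ w_K = 2` (`X2.not_dvd_unitsTorsionOrder_of_discr_lt`),
`ord_p u(Cd) = 0` (`padicValRat_u_eq_zero_of_twist_minimal`: `p ∥ N` splits in `K`), `p ∤ d_K`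
(`SatisfiesHeegnerHypothesis.not_dvd_discr`: `p ∣ N_E`), `p² ∤ N_E` (`not_sq_dvd_conductorNorm_of_mult`:
conductor exponent `1` at a multiplicative prime), non-CM (`not_mult_of_hasCM`, Silverman ATAEC
II.6.4); the Manin binder `p ∤ c(Dt)` stays displayed. No (ram) prime, no surjectivity assumed.
Per pair; NOT a class theorem; X11b's label unchanged; nothing booked; to be read WITH BOTH FLAGS.
[cite: Miller2011LMS, Thm. 5.4, Thm. 5.2 (arXiv:1010.2431 p. 11) and Def. 1.1]
[cite: Jetchev2008, Hypothesis (*), Cor. 1.5 (p. 3), Rem. 6.2 (p. 15)]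
[cite: JetchevSkinnerWan2017, §7.4.1 (eq:gz for K′), pp. 29–30]
[cite: SilvermanATAEC1994, Thm. II.6.4 (PDF p. 148)] [cite: SilvermanAEC2009, VII.1 Prop. 1.3(b) and Thm. X.4.2(a)] -/
theorem ClassX11b.bsdp_of_millerJetchev_of_card_selmer_of_indexRecord
    (hGZ : gross_zagier (W.conductorNorm ℤ) W K) (hKo : kolyvagin (W.conductorNorm ℤ) W K)
    (hGZK : rank_eq_analyticRank_of_analyticRank_le_one) (hmod : hasEntireLFunction_rat)
    (hMJ : thm54_cha_padicValNat_shaOrder_add_tamagawa_le)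
    (hX : ClassX11b W p)
    (hK : IsImaginaryQuadratic K) (hdK : NumberField.discr K < -4)
    (hHN : SatisfiesHeegnerHypothesis (W.conductorNorm ℤ) K)
    (hP : WeierstrassCurve.Affine.Point.map ι.toRatAlgHom P = heegnerPointComplex Dt H)
    (hc : ¬ (p : ℤ) ∣ Dt.c)
    (Wd : WeierstrassCurve ℚ) [Wd.IsElliptic] [Wd.IsGloballyMinimal] (Cd : VariableChange ℚ)
    (hWd : Cd • W.quadraticTwist (NumberField.discr K : ℚ) = Wd)
    (qd : ℚ) (hqd : Wd.entireLFunction 1 / (Wd.realPeriodRat : ℂ) = (qd : ℂ)) (hqd0 : qd ≠ 0)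
    (q : ℕ) [Fact q.Prime] (hqN : q ∣ W.conductorNorm ℤ) {k : ℕ}
    (hI : padicValNat p (AddSubgroup.zmultiples P).index ≤
      k + padicValNat p ((W.baseChange ℚ_[q]).localTamagawaNumber ℤ_[q]))
    (hrec : 2 * (padicValNat p (AddSubgroup.zmultiples P).index : ℤ) =
      (2 * k : ℕ) + padicValRat p qd + padicValNat p W.tamagawaProduct)
    (hcard : Nat.card (W.selmerGroup (p : ℤ)) = p ^ (1 + 2 * k)) :
    BSDp W p := by
  obtain ⟨hr, hp2, hmult, hirr⟩ := hX
  have hp : p.Prime := Fact.out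
  have hμ : ¬ p ∣ Units.torsionOrder K := X2.not_dvd_unitsTorsionOrder_of_discr_lt hK hdK Fact.out hp2
  have hu : padicValRat p (Cd.u : ℚ) = 0 :=
    padicValRat_u_eq_zero_of_twist_minimal W p K hK hHN hmult Cd hWd
  have hpN' : p ∣ W.conductorNorm ℤ :=
    (W.dvd_conductorNorm_iff_not_hasGoodReductionAtPrime p).mpr
      (WeierstrassCurve.HasMultiplicativeReduction.not_hasGoodReduction (R := ℤ_[p]) hmult)
  have hpD : ¬ (p : ℤ) ∣ NumberField.discr K :=
    Literature.SatisfiesHeegnerHypothesis.not_dvd_discr hK.1 hHN hp hpN'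
  have hpN : ¬ p ^ 2 ∣ W.conductorNorm ℤ := not_sq_dvd_conductorNorm_of_mult W p hmult
  have hcm : ¬ W.HasCM := fun hCM ↦ not_mult_of_hasCM W hCM p hmult
  exact X11b.bsdp_of_millerJetchev_of_card_selmer_of_indexRecord W p (W.conductorNorm ℤ) K Dt H ι P
    hGZ hKo hGZK hmod hMJ hK hHN hP hp2 hc hμ hr hirr hcm hpD hpN Wd Cd hWd hu qd hqd hqd0 q hqN hI hrec
    hcard

end Conductor

/-! ### §3. The `p = 3` rows (`IsX11Three` / `ClassX11b W 3`): the (T2′) LB3 shape, LB3+JET -/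

section Three

variable (W : WeierstrassCurve ℚ) [W.IsElliptic] [W.IsGloballyMinimal] [NeZero (W.conductorNorm ℤ)]
  (K : Type) [Field K] [NumberField K] (Dt : ModularParametrizationData W (W.conductorNorm ℤ))
  (H : HeegnerDatum (W.conductorNorm ℤ) (NumberField.discr K)) (ι : K →+* ℂ)
  (P : (W.baseChange K).toAffine.Point)

/-- **The (T2′) LB3 rows at `p = 3`, `hs`-free**: `IsX11Three W` (`3 ∥ N`, `E[3]` irreducible,
`r_an = 1`), EXACT `#Sel^(3)(E/ℚ) = 27`, ONE prime `q ∣ N_E` with `3 ∣ c_q(E)` (`1 ≤ ord₃ c_q`), and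
the exact index record at a Heegner field with `d_K < −4`: `ord₃ [E(K):ℤP] ≤ 2` and
`2·ord₃ [E(K):ℤP] = 2 + ord₃ q_d + ord₃ ∏_ℓ c_ℓ(E)` ⇒ `BSD(E,3)` — team x11b3's
`X11b.Three.IsX11Three.bsdp_of_millerJetchev_of_card_selmerThree_eq` with `hs`/`hv : ord₃ s = 2`
REPLACED by the record and Carayol's binder `hC` REPLACED by the conductor-level datum (§2). FLAGS
`Miller11-Thm54-Cha-case` + `JET@3|N`. EVIDENCE pointer (nothing asserted): the five classes
`191424ce1`, `318828a1`, `368358k1`, `463488bg1`, `498525ca1` (`ord₃ m = 2`, `ord₃ S_D = 1`,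
`v₃(∏c_ℓ) = 1`: `4 = 2 + 1 + 1`; `q = 3, 2, 29, 3, 17`). Per pair; X11 ∧ `r = 1` ∧ `p = 3` stays
CONSTRUCTION-SHAPED; nothing booked. [cite: Miller2011LMS, Thm. 5.4, Thm. 5.2 and Def. 1.1]
[cite: Jetchev2008, Cor. 1.5 (p. 3), Rem. 6.2 (p. 15)] [cite: JetchevSkinnerWan2017, §7.4.1 (eq:gz for K′), pp. 29–30] -/
theorem IsX11Three.bsdp_of_millerJetchev_of_card_selmerThree_eq_of_indexRecord
    (hGZ : gross_zagier (W.conductorNorm ℤ) W K) (hKo : kolyvagin (W.conductorNorm ℤ) W K)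
    (hGZK : rank_eq_analyticRank_of_analyticRank_le_one) (hmod : hasEntireLFunction_rat)
    (hMJ : thm54_cha_padicValNat_shaOrder_add_tamagawa_le)
    (hX : IsX11Three W)
    (hK : IsImaginaryQuadratic K) (hdK : NumberField.discr K < -4)
    (hHN : SatisfiesHeegnerHypothesis (W.conductorNorm ℤ) K)
    (hP : WeierstrassCurve.Affine.Point.map ι.toRatAlgHom P = heegnerPointComplex Dt H)
    (hc : ¬ (3 : ℤ) ∣ Dt.c)
    (Wd : WeierstrassCurve ℚ) [Wd.IsElliptic] [Wd.IsGloballyMinimal] (Cd : VariableChange ℚ)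
    (hWd : Cd • W.quadraticTwist (NumberField.discr K : ℚ) = Wd)
    (qd : ℚ) (hqd : Wd.entireLFunction 1 / (Wd.realPeriodRat : ℂ) = (qd : ℂ)) (hqd0 : qd ≠ 0)
    (q : ℕ) [Fact q.Prime] (hqN : q ∣ W.conductorNorm ℤ)
    (hcq : 1 ≤ padicValNat 3 ((W.baseChange ℚ_[q]).localTamagawaNumber ℤ_[q]))
    (hI : padicValNat 3 (AddSubgroup.zmultiples P).index ≤ 2)
    (hrec : 2 * (padicValNat 3 (AddSubgroup.zmultiples P).index : ℤ) =
      2 + padicValRat 3 qd + padicValNat 3 W.tamagawaProduct)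
    (hcard : Nat.card (W.selmerGroup (3 : ℤ)) = 27) :
    BSDp W 3 :=
  haveI : Fact (Nat.Prime 3) := ⟨by norm_num⟩
  ClassX11b.bsdp_of_millerJetchev_of_card_selmer_of_indexRecord W 3 K Dt H ι P hGZ hKo hGZK hmod hMJ
    (classX11b_three_of_isX11Three W hX) hK hdK hHN hP (by exact_mod_cast hc) Wd Cd hWd qd hqd hqd0 q
    hqN (k := 1) (by omega) (by rw [hrec]; push_cast; ring)
    (by rw [show ((3 : ℕ) : ℤ) = 3 by norm_num, hcard]; norm_num)

/-- **The same in the vocabulary of `ClassX11b W 3`** (`r_an = 1 ∧ 3 ≠ 2 ∧ mult(3) ∧ irr(3)`,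
`Partition/Rows.lean`): EXACT `#Sel₃ = 27`, ONE `q ∣ N_E` with `3 ∣ c_q(E)`, `ord₃ [E(K):ℤP] ≤ 2`,
record equation `2·ord₃ [E(K):ℤP] = 2 + ord₃ q_d + ord₃ ∏c_ℓ(E)` at a Heegner field with `d_K < −4`
⇒ `BSD(E,3)`. FLAGS `Miller11-Thm54-Cha-case` + `JET@3|N`. Per pair; nothing booked; label unchanged.
[cite: Miller2011LMS, Thm. 5.4, Thm. 5.2 and Def. 1.1] [cite: Jetchev2008, Cor. 1.5 (p. 3)] -/
theorem ClassX11b.bsdp_three_of_millerJetchev_of_card_selmerThree_eq_of_indexRecord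
    (hGZ : gross_zagier (W.conductorNorm ℤ) W K) (hKo : kolyvagin (W.conductorNorm ℤ) W K)
    (hGZK : rank_eq_analyticRank_of_analyticRank_le_one) (hmod : hasEntireLFunction_rat)
    (hMJ : thm54_cha_padicValNat_shaOrder_add_tamagawa_le)
    [Fact (Nat.Prime 3)] (hX : ClassX11b W 3)
    (hK : IsImaginaryQuadratic K) (hdK : NumberField.discr K < -4)
    (hHN : SatisfiesHeegnerHypothesis (W.conductorNorm ℤ) K)
    (hP : WeierstrassCurve.Affine.Point.map ι.toRatAlgHom P = heegnerPointComplex Dt H)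
    (hc : ¬ (3 : ℤ) ∣ Dt.c)
    (Wd : WeierstrassCurve ℚ) [Wd.IsElliptic] [Wd.IsGloballyMinimal] (Cd : VariableChange ℚ)
    (hWd : Cd • W.quadraticTwist (NumberField.discr K : ℚ) = Wd)
    (qd : ℚ) (hqd : Wd.entireLFunction 1 / (Wd.realPeriodRat : ℂ) = (qd : ℂ)) (hqd0 : qd ≠ 0)
    (q : ℕ) [Fact q.Prime] (hqN : q ∣ W.conductorNorm ℤ)
    (hcq : 1 ≤ padicValNat 3 ((W.baseChange ℚ_[q]).localTamagawaNumber ℤ_[q]))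
    (hI : padicValNat 3 (AddSubgroup.zmultiples P).index ≤ 2)
    (hrec : 2 * (padicValNat 3 (AddSubgroup.zmultiples P).index : ℤ) =
      2 + padicValRat 3 qd + padicValNat 3 W.tamagawaProduct)
    (hcard : Nat.card (W.selmerGroup (3 : ℤ)) = 27) :
    BSDp W 3 :=
  IsX11Three.bsdp_of_millerJetchev_of_card_selmerThree_eq_of_indexRecord W K Dt H ι P hGZ hKo hGZK
    hmod hMJ ⟨hX.2.2.1, hX.2.2.2, hX.1⟩ hK hdK hHN hP hc Wd Cd hWd qd hqd hqd0 q hqN hcq hI hrec hcard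

/-- **General `p = 3` form** (any `k`): `IsX11Three W`, the inflated index certificate
`ord₃ [E(K):ℤP] ≤ k + ord₃ c_q(E)` at ONE prime `q ∣ N_E`, the record equation
`2·ord₃ [E(K):ℤP] = 2k + ord₃ q_d + ord₃ ∏c_ℓ(E)` at a Heegner field with `d_K < −4`, and EXACT
`#Sel^(3)(E/ℚ) = 3^(1+2k)` ⇒ `BSD(E,3)` (`k = 0`: a Miller–Jetchev index certificate with
`#Sel₃ = 3`; `k = 1`: the (T2′) LB3 rows above). FLAGS `Miller11-Thm54-Cha-case` + `JET@3|N`.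
Per pair; label unchanged; nothing booked. [cite: Miller2011LMS, Thm. 5.4, Thm. 5.2 and Def. 1.1]
[cite: Jetchev2008, Cor. 1.5 (p. 3)] [cite: JetchevSkinnerWan2017, §7.4.1 (eq:gz for K′), pp. 29–30] -/
theorem IsX11Three.bsdp_of_millerJetchev_of_card_selmerThree_of_indexRecord
    (hGZ : gross_zagier (W.conductorNorm ℤ) W K) (hKo : kolyvagin (W.conductorNorm ℤ) W K)
    (hGZK : rank_eq_analyticRank_of_analyticRank_le_one) (hmod : hasEntireLFunction_rat)
    (hMJ : thm54_cha_padicValNat_shaOrder_add_tamagawa_le)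
    (hX : IsX11Three W)
    (hK : IsImaginaryQuadratic K) (hdK : NumberField.discr K < -4)
    (hHN : SatisfiesHeegnerHypothesis (W.conductorNorm ℤ) K)
    (hP : WeierstrassCurve.Affine.Point.map ι.toRatAlgHom P = heegnerPointComplex Dt H)
    (hc : ¬ (3 : ℤ) ∣ Dt.c)
    (Wd : WeierstrassCurve ℚ) [Wd.IsElliptic] [Wd.IsGloballyMinimal] (Cd : VariableChange ℚ)
    (hWd : Cd • W.quadraticTwist (NumberField.discr K : ℚ) = Wd)
    (qd : ℚ) (hqd : Wd.entireLFunction 1 / (Wd.realPeriodRat : ℂ) = (qd : ℂ)) (hqd0 : qd ≠ 0)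
    (q : ℕ) [Fact q.Prime] (hqN : q ∣ W.conductorNorm ℤ) {k : ℕ}
    (hI : padicValNat 3 (AddSubgroup.zmultiples P).index ≤
      k + padicValNat 3 ((W.baseChange ℚ_[q]).localTamagawaNumber ℤ_[q]))
    (hrec : 2 * (padicValNat 3 (AddSubgroup.zmultiples P).index : ℤ) =
      (2 * k : ℕ) + padicValRat 3 qd + padicValNat 3 W.tamagawaProduct)
    (hcard : Nat.card (W.selmerGroup (3 : ℤ)) = 3 ^ (1 + 2 * k)) :
    BSDp W 3 :=
  haveI : Fact (Nat.Prime 3) := ⟨by norm_num⟩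
  ClassX11b.bsdp_of_millerJetchev_of_card_selmer_of_indexRecord W 3 K Dt H ι P hGZ hKo hGZK hmod hMJ
    (classX11b_three_of_isX11Three W hX) hK hdK hHN hP (by exact_mod_cast hc) Wd Cd hWd qd hqd hqd0 q
    hqN (k := k) hI hrec (by rw [show ((3 : ℕ) : ℤ) = 3 by norm_num]; exact hcard)

end Three

end Summit.BirchSwinnertonDyer.Rank1Residual.X11b

end
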